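import Summits.ResolutionOfSingularities.ResolutionOfSingularities.Theorems.WeightedInvariantLocalWeightedDropWildPurePowerFlagStepZero
import Summits.ResolutionOfSingularities.ResolutionOfSingularities.Theorems.WeightedInvariantLocalWeightedDropWildPurePowerFlagBasic
import Summits.ResolutionOfSingularities.ResolutionOfSingularities.Theorems.WeightedInvariantLocalWeightedDropWildPurePowerFlagStatements
import Literature.AlgebraicGeometry.Resolution.PointBlowupFlagDropExceptionalY

/-!
# `LocalWeightedDrop`, piece S3πM: [HP24, Prop. 4] case (i) on the game side — the `n = 0` flags of the axis successor

Crux item stmt-ResolutionOfSingularities-8899 `LocalWeightedDrop`, class stub S3πM `stub_wildPurelyInseparableReductionWon`,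
sub-target `PurePowerFlag.DropStatement` at `t = 0`.  [OURS · L1 W4.3, chain w43, seat res-D-pv-058 acting as res-L1-w43-stub-6.  The
printed mathematics is H. Hauser, S. Perlega, Publ. RIMS **60** (2024): Prop. 3 (p. 792: the maximizing flag, finiteness of `s`) and
Prop. 4 proof case (i) (pp. 794–795: "`n_𝓖 = 0` and `t = 0` … `d′_res ≤ d_res` … `coeff_{d}(G′) = x^{−d_res}·coeff_{d}(G)` … This
proves that `s_𝓖 < s_𝓕`"), formalised at series level in `Literature/…/PointBlowupFlagMaximalShift`, `…DropMonomialStep`,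
`…DropCompanion`, `…DropExceptionalY`; this file is the GLUE to `PurePowerFlag.*` (p504698).  Not a statement of any manuscript.]

For a clean non-terminal position `B` (`cleanSeries q B = B`, `B ≠ 0`, `q ≤ ord B`, `¬ TermSub q B`) and its axis successor `T`
(`X 0 ^ q * T = subst (dirChart 0) B`), with the letters `E′ ∋ 0`, `1 ∈ E′ ↔ 1 ∈ E`:
* `dRes B E = 0 ⇒ TermSub q B` (`termSub_of_dRes_eq_zero`); `sFlag = ⊤` along an `n = 0` flag `⇒ TermSub q B` (hidden monomial,
  `termSub_of_sFlag_eq_top`); **[HP24, Prop. 3], `s`-component** (`exists_isGreatest_sFlag`: a maximizing `n = 0` flag, finite `s`);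
* **`sFlag q T E′ h + d_res! = sFlag q B E (X·h)`** when `d′_res = d_res ≥ q` and `y ∉ E` (`sFlag_stepZero_add_factorial`);
* **[HP24, Prop. 4 (i)] for the first orientation, `y ∉ E`, `d_res ≥ q`** (`exists_gt_of_isN0_stepZero`): every `n = 0` flag triple of
  `(T, E′)` is strictly dominated by an admissible flag triple of `(B, E)`.
-/

set_option linter.dupNamespace false -- mandated namespace of this single-conjunct summit

namespace Summit.ResolutionOfSingularities.ResolutionOfSingularities.Theorems

open Literature.AlgebraicGeometry.Resolution
open Literature.AlgebraicGeometry.Resolution.HauserPerlega2024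

namespace PurePowerFlag

open MvPowerSeries

variable {k : Type} [Field k]

/-! ### Two-letter bookkeeping -/

/-- the exponent `x^a y^b` at `0`. -/
private theorem f_l (a b : ℕ) : (Finsupp.single (0 : Fin 2) a + Finsupp.single (1 : Fin 2) b : Fin 2 →₀ ℕ) 0 = a := by
  rw [Finsupp.add_apply, Finsupp.single_eq_same, Finsupp.single_apply, if_neg (by decide), add_zero]

/-- the exponent `x^a y^b` at `1`. -/
private theorem f_r (a b : ℕ) : (Finsupp.single (0 : Fin 2) a + Finsupp.single (1 : Fin 2) b : Fin 2 →₀ ℕ) 1 = b := by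
  rw [Finsupp.add_apply, Finsupp.single_eq_same, Finsupp.single_apply, if_neg (by decide), zero_add]

/-- an exponent on two letters is `x^{m 0} y^{m 1}`. -/
private theorem f_ssa (m : Fin 2 →₀ ℕ) : m = Finsupp.single 0 (m 0) + Finsupp.single 1 (m 1) := by
  ext l
  rcases fin_two_cases l with rfl | rfl
  · rw [f_l]
  · rw [f_r]

/-- the degree on two letters. -/
private theorem f_deg (m : Fin 2 →₀ ℕ) : m.degree = m 0 + m 1 := by
  rw [Finsupp.degree_eq_sum, Fin.sum_univ_two]

/-- the exceptional exponent as `x^{r_x} y^{r_y}`. -/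
private theorem excExp_eq_single_add' (B : MvPowerSeries (Fin 2) k) (E : Finset (Fin 2)) :
    excExp B E = Finsupp.single 0 (excExp B E 0) + Finsupp.single 1 (excExp B E 1) := f_ssa _

/-- `r_y = 0` when `y` is not exceptional. -/
private theorem excExp_one_of_not_mem' {B : MvPowerSeries (Fin 2) k} {E : Finset (Fin 2)} (h1 : (1 : Fin 2) ∉ E) : excExp B E 1 = 0 := by
  rw [excExp_apply, if_neg h1]

/-- `r_x = 0` when `x` is not exceptional. -/
private theorem excExp_zero_of_not_mem' {B : MvPowerSeries (Fin 2) k} {E : Finset (Fin 2)} (h0 : (0 : Fin 2) ∉ E) : excExp B E 0 = 0 := by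
  rw [excExp_apply, if_neg h0]

/-- **the rows of the residual factor** relative to the exceptional monomial `x^{r_x} y^{r_y}`. [HP24 §5 p. 783: "F = M·G"] -/
private theorem coeff_residual' (q : ℕ) (C : MvPowerSeries (Fin 2) k) (E : Finset (Fin 2)) (h : PowerSeries k) (v j : ℕ) :
    coeff (Finsupp.single 0 v + Finsupp.single 1 j) (residual q C E h) =
      coeff (Finsupp.single 0 (excExp C E 0 + v) + Finsupp.single 1 (excExp C E 1 + j)) (expansion q C h) := by
  have hd : Finsupp.single (0 : Fin 2) v + Finsupp.single 1 j + excExp C E =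
      Finsupp.single 0 (excExp C E 0 + v) + Finsupp.single 1 (excExp C E 1 + j) := by
    ext l
    rcases fin_two_cases l with rfl | rfl
    · rw [Finsupp.add_apply, f_l, f_l, add_comm]
    · rw [Finsupp.add_apply, f_r, f_r, add_comm]
  unfold residual
  show coeff (Finsupp.single 0 v + Finsupp.single 1 j + excExp C E) _ = _
  rw [hd]

/-- **`s_𝓕` for `d_res ≥ q` (or `d_res = 0`), unfolded** as the minimum over the rows of the residual factor. [HP24 §5 p. 783] -/
private theorem sFlag_eq_inf_of_le' (q : ℕ) (C : MvPowerSeries (Fin 2) k) (E : Finset (Fin 2)) (h : PowerSeries k)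
    (hq : q ≤ dRes C E ∨ dRes C E = 0) :
    sFlag q C E h = (Finset.range (dRes C E)).inf fun i =>
      (((dRes C E).factorial / (dRes C E - i) : ℕ) : ℕ∞) *
        (PowerSeries.mk fun a => coeff (Finsupp.single 0 a + Finsupp.single 1 i) (residual q C E h)).order := by
  unfold sFlag
  rw [if_pos hq]
  unfold coeffIdealOrder
  rw [← Finset.inf_eq_iInf]
  exact Finset.inf_congr rfl fun i _ => by rw [rowOrder_eq_order_mk]

/-- the expansion along the zero shift of a clean series is the series. -/
private theorem expansion_zero_of_clean' (q : ℕ) {C : MvPowerSeries (Fin 2) k} (hC : cleanSeries q C = C) : expansion q C 0 = C := by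
  unfold expansion
  rw [shift_eq, subst_shift_zero 0 1 C, hC]

/-- the order bound: every monomial of `B ≠ 0` has degree `≥ r_x + r_y + d_res`. [HP24 §4 p. 776] -/
private theorem excExp_add_dRes_le_of_coeff_ne_zero' {B : MvPowerSeries (Fin 2) k} (hB : B ≠ 0) (E : Finset (Fin 2))
    {m : Fin 2 →₀ ℕ} (hm : coeff m B ≠ 0) : excExp B E 0 + excExp B E 1 + dRes B E ≤ m 0 + m 1 := by
  rw [← order_toNat_eq_excExp_add_dRes hB E]
  have h1 := MvPowerSeries.order_le hm
  rw [← (MvPowerSeries.ne_zero_iff_order_finite).mp hB, f_deg] at h1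
  exact_mod_cast h1

/-- a monomial of degree exactly `r_x + r_y + d_res` in `B ≠ 0`. [HP24 §4 p. 776 (ord G = d_res)] -/
private theorem exists_coeff_ne_zero_degree_eq' {B : MvPowerSeries (Fin 2) k} (hB : B ≠ 0) (E : Finset (Fin 2)) :
    ∃ m, coeff m B ≠ 0 ∧ m 0 + m 1 = excExp B E 0 + excExp B E 1 + dRes B E := by
  obtain ⟨m₀, hm₀, hdeg⟩ := MvPowerSeries.exists_coeff_ne_zero_and_order ((MvPowerSeries.ne_zero_iff_order_finite).mp hB)
  refine ⟨m₀, hm₀, ?_⟩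
  rw [← order_toNat_eq_excExp_add_dRes hB E]
  have h2 : ((m₀ 0 + m₀ 1 : ℕ) : ℕ∞) = (B.order.toNat : ℕ∞) := by
    rw [← f_deg, hdeg, (MvPowerSeries.ne_zero_iff_order_finite).mp hB]
  exact_mod_cast h2

/-! ### Terminal exits -/

/-- a literal terminal shape of the cleaned expansion along a first-orientation flag makes the position terminal. -/
private theorem termSub_of_isTermShape_expansion' (q : ℕ) (B : MvPowerSeries (Fin 2) k) {h : PowerSeries k}
    (h0 : PowerSeries.constantCoeff h = 0) (hT : IsTermShape q (expansion q B h)) : TermSub q B :=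
  ⟨false, h, h0, hT⟩

/-! ### Case `n = 0`, first orientation, `y ∉ E`: the rows relative to `x^{r_x}` -/

section NotMem

variable (p : ℕ) [Fact p.Prime] [CharP k p] {e : ℕ}

/-- the rows of the residual factor along the flag `h` are the rows, relative to `x^{r_x}`, of the cleaned expansion (`y ∉ E`). -/
private theorem coeff_row_residual_of_not_mem' (q : ℕ) (B : MvPowerSeries (Fin 2) k) {E : Finset (Fin 2)} (h1 : (1 : Fin 2) ∉ E)
    (h : PowerSeries k) (j v : ℕ) :
    PowerSeries.coeff v (PowerSeries.mk fun a => coeff (Finsupp.single 0 a + Finsupp.single 1 j) (residual q B E h)) =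
      coeff (Finsupp.single 0 (excExp B E 0 + v) + Finsupp.single 1 j)
        (cleanSeries q (subst (fun l : Fin 2 => if l = (1 : Fin 2) then
          (X 1 : MvPowerSeries (Fin 2) k) + PowerSeries.subst (X 0 : MvPowerSeries (Fin 2) k) h else X l) B)) := by
  rw [PowerSeries.coeff_mk, coeff_residual', excExp_one_of_not_mem' h1, zero_add]
  rfl

/-- **`sFlag = ⊤` along an `n = 0` flag is a hidden monomial case** (`y ∉ E`, `d_res ≥ q`): then `B` is terminal up to the triangular
change `y ↦ y + h(x)`. [HP24 Prop. 3 proof p. 792 l. 31–40] -/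
theorem termSub_of_sFlag_eq_top {B : MvPowerSeries (Fin 2) k} (hB : cleanSeries (p ^ e) B = B) (hB0 : B ≠ 0)
    {E : Finset (Fin 2)} (h1 : (1 : Fin 2) ∉ E) (hq : p ^ e ≤ dRes B E) {h : PowerSeries k}
    (h0 : PowerSeries.constantCoeff h = 0) (htop : sFlag (p ^ e) B E h = ⊤) : TermSub (p ^ e) B := by
  classical
  set r := excExp B E 0 with hr
  set d := dRes B E with hd
  have hry := excExp_one_of_not_mem' (B := B) h1
  have hxr : ∀ m, coeff m B ≠ 0 → r ≤ m 0 := fun m hm => excExp_le_of_coeff_ne_zero B E hm 0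
  have hmin : ∀ m, coeff m B ≠ 0 → r + d ≤ m 0 + m 1 := fun m hm => by
    have := excExp_add_dRes_le_of_coeff_ne_zero' hB0 E hm; rw [hry] at this; omega
  have hex : ∃ m, coeff m (cleanSeries (p ^ e) B) ≠ 0 ∧ m 0 + m 1 = r + d := by
    obtain ⟨m, hm, hdeg⟩ := exists_coeff_ne_zero_degree_eq' hB0 E
    exact ⟨m, by rw [hB]; exact hm, by rw [hry] at hdeg; omega⟩
  rw [sFlag_eq_inf_of_le' (p ^ e) B E h (Or.inl hq)] at htop
  obtain ⟨u, hfac, hu, hndvd⟩ := exists_eq_monomial_mul_of_inf_rows_eq_top p 0 1 zero_ne_one_fin fin_two_cases B r d hxr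
    hmin hex h h0 _ (coeff_row_residual_of_not_mem' (p ^ e) B h1 h) htop
  refine termSub_of_isTermShape_expansion' (p ^ e) B h0 (Or.inl ⟨r, d, u, hu, hndvd, ?_⟩)
  unfold expansion
  rw [shift_eq, hfac, X_pow_eq, X_pow_eq, monomial_mul_monomial, one_mul]

/-- **[HP24, Prop. 3] — the `s`-component on the game side** (`y ∉ E`, `d_res ≥ q`, `B` clean, non-zero, not terminal): there is
an `n = 0` flag `h⋆` whose `sFlag` is FINITE and GREATEST among all `n = 0` flags of `(B, E)`. [HP24 Prop. 3 p. 791 – p. 792] -/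
theorem exists_isGreatest_sFlag {B : MvPowerSeries (Fin 2) k} (hB : cleanSeries (p ^ e) B = B) (hB0 : B ≠ 0)
    {E : Finset (Fin 2)} (h1 : (1 : Fin 2) ∉ E) (hq : p ^ e ≤ dRes B E) (hnt : ¬ TermSub (p ^ e) B) :
    ∃ hmax : PowerSeries k, PowerSeries.constantCoeff hmax = 0 ∧ sFlag (p ^ e) B E hmax < ⊤ ∧
      ∀ h : PowerSeries k, PowerSeries.constantCoeff h = 0 → sFlag (p ^ e) B E h ≤ sFlag (p ^ e) B E hmax := by
  classical
  set r := excExp B E 0 with hr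
  set d := dRes B E with hd
  have hry := excExp_one_of_not_mem' (B := B) h1
  have hxr : ∀ m, coeff m B ≠ 0 → r ≤ m 0 := fun m hm => excExp_le_of_coeff_ne_zero B E hm 0
  have hmin : ∀ m, coeff m B ≠ 0 → r + d ≤ m 0 + m 1 := fun m hm => by
    have := excExp_add_dRes_le_of_coeff_ne_zero' hB0 E hm; rw [hry] at this; omega
  have hex : ∃ m, coeff m (cleanSeries (p ^ e) B) ≠ 0 ∧ m 0 + m 1 = r + d := by
    obtain ⟨m, hm, hdeg⟩ := exists_coeff_ne_zero_degree_eq' hB0 E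
    exact ⟨m, by rw [hB]; exact hm, by rw [hry] at hdeg; omega⟩
  set R : PowerSeries k → ℕ → PowerSeries k := fun φ j => PowerSeries.mk fun a =>
    coeff (Finsupp.single 0 a + Finsupp.single 1 j) (residual (p ^ e) B E φ) with hRdef
  have hR := fun φ j v => coeff_row_residual_of_not_mem' (p ^ e) B h1 φ j v
  have hs : ∀ φ, sFlag (p ^ e) B E φ = (Finset.range d).inf (fun i => ((d.factorial / (d - i) : ℕ) : ℕ∞) * (R φ i).order) :=
    fun φ => sFlag_eq_inf_of_le' (p ^ e) B E φ (Or.inl hq)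
  rcases exists_isGreatest_inf_rows_or_monomial p 0 1 zero_ne_one_fin fin_two_cases B r d hq hxr hmin hex R hR with
    ⟨φ, hφ, u, hfac, hu, hndvd⟩ | ⟨φ, hφ, hlt, hge⟩
  · exact absurd (termSub_of_isTermShape_expansion' (p ^ e) B hφ (Or.inl ⟨r, d, u, hu, hndvd, by
      unfold expansion; rw [shift_eq, hfac, X_pow_eq, X_pow_eq, monomial_mul_monomial, one_mul]⟩)) hnt
  · exact ⟨φ, hφ, by rw [hs]; exact hlt, fun h hh => by rw [hs, hs]; exact hge h hh⟩

/-- **[HP24, Prop. 4 (i)]: `s_𝓖 + d_res! = s_𝓕`** on the game side (`y ∉ E`, `d′_res = d_res ≥ q`): along the axis successor,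
`sFlag q T E′ h + d! = sFlag q B E (X·h)` — the flag `y + h(x)` of the successor against the flag `y + x·h(x)` of the parent.
[HP24 Prop. 4 (i) p. 794 l. 22 – p. 795 l. 5] -/
theorem sFlag_stepZero_add_factorial (q : ℕ) {B T : MvPowerSeries (Fin 2) k} (hB0 : B ≠ 0)
    (hqo : ((q : ℕ) : ℕ∞) ≤ B.order) (hT : (X 0 : MvPowerSeries (Fin 2) k) ^ q * T = subst (PlaneGerm.dirChart (0 : k)) B)
    {E E' : Finset (Fin 2)} (h0 : (0 : Fin 2) ∈ E') (h1 : (1 : Fin 2) ∉ E) (h1' : (1 : Fin 2) ∉ E') (hq : q ≤ dRes B E)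
    (hd : dRes T E' = dRes B E) (h : PowerSeries k) (hh : PowerSeries.constantCoeff h = 0) :
    sFlag q T E' h + ((dRes B E).factorial : ℕ∞) = sFlag q B E (PowerSeries.X * h) := by
  classical
  have hT' := hT
  rw [subst_dirChart_zero_eq] at hT'
  set r := excExp B E 0 with hr
  set d := dRes B E with hdd
  set r' := excExp T E' 0 with hr'
  have hry := excExp_one_of_not_mem' (B := B) h1
  have hfin := (MvPowerSeries.ne_zero_iff_order_finite).mp hB0
  have hmin : ∀ m, coeff m B ≠ 0 → r + d ≤ m 0 + m 1 := fun m hm => by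
    have := excExp_add_dRes_le_of_coeff_ne_zero' hB0 E hm; rw [hry] at this; omega
  have hr'q : r' + q = r + d := by
    have ho := order_toNat_eq_excExp_add_dRes hB0 E
    rw [hry, add_zero] at ho
    have hqo' : q ≤ B.order.toNat := by rw [← hfin] at hqo; exact_mod_cast hqo
    have h2 : ((r' : ℕ) : ℕ∞) = ((B.order.toNat - q : ℕ) : ℕ∞) := by
      rw [hr', excExp_apply, if_pos h0, ordAlong_zero_stepZero q hB0 hqo hT, ENat.toNat_coe]
    have h3 : r' = B.order.toNat - q := by exact_mod_cast h2
    omega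
  have hXh : PowerSeries.constantCoeff (PowerSeries.X * h) = 0 := by rw [map_mul, PowerSeries.constantCoeff_X, zero_mul]
  have hmain := inf_rows_step_add_factorial q 0 1 zero_ne_one_fin fin_two_cases B T hT' r r' d hr'q hmin h hh _ _
    (coeff_row_residual_of_not_mem' q B h1 (PowerSeries.X * h)) (coeff_row_residual_of_not_mem' q T h1' h)
  rw [sFlag_eq_inf_of_le' q T E' h (Or.inl (by rw [hd]; exact hq)), sFlag_eq_inf_of_le' q B E _ (Or.inl hq), hd]
  exact hmain

/-- **[HP24, Prop. 4] case (i), FIRST ORIENTATION, `y ∉ E`, `d_res ≥ q`, ON THE GAME SIDE**: for the axis successor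
`X 0 ^ q · T = B(x, xy)` of a clean non-terminal position `B` and every shift `h` (an `n = 0` flag of `(T, E′)`, `E′ ∌ y`), there is an
admissible flag triple `v` of `(B, E)` with `flagTriple q T E′ h < v`: either `d′_res < d_res` (then `v` = the triple of the zero shift),
or `d′_res = d_res` and `s_𝓖 + d_res! ≤ s_{𝓕⋆}` for the maximizing `n = 0` flag `𝓕⋆` of Proposition 3.
[HP24 Prop. 4 (i) p. 794 l. 22 – p. 795 l. 5] -/
theorem exists_gt_of_isN0_stepZero {B T : MvPowerSeries (Fin 2) k} (hB : cleanSeries (p ^ e) B = B) (hB0 : B ≠ 0)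
    (hqo : ((p ^ e : ℕ) : ℕ∞) ≤ B.order) (hnt : ¬ TermSub (p ^ e) B)
    (hT : (X 0 : MvPowerSeries (Fin 2) k) ^ (p ^ e) * T = subst (PlaneGerm.dirChart (0 : k)) B)
    {E E' : Finset (Fin 2)} (h0 : (0 : Fin 2) ∈ E') (h1 : (1 : Fin 2) ∉ E) (h1' : (1 : Fin 2) ∉ E') (hq : p ^ e ≤ dRes B E)
    (h : PowerSeries k) (hh : PowerSeries.constantCoeff h = 0) :
    ∃ v : Triple, IsFlagTriple (p ^ e) B E v ∧ flagTriple (p ^ e) T E' h < v := by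
  classical
  have hN0' : IsN0 E' h := Or.inl h1'
  rw [flagTriple_of_isN0 (p ^ e) T hN0']
  rcases (dRes_stepZero_le (p ^ e) hB0 hqo hT h0 (E := E) ⟨fun h => absurd h h1', fun h => absurd h h1⟩).lt_or_eq with hlt | heq
  · -- `d′_res < d_res`: the zero shift of the parent wins on the first component
    refine ⟨flagTriple (p ^ e) B E 0, isFlagTriple_zero (p ^ e) B E, ?_⟩
    rw [flagTriple_of_isN0 (p ^ e) B (Or.inr rfl), Prod.Lex.toLex_lt_toLex]
    left; exact hlt
  · -- `d′_res = d_res`: the maximizing flag of Proposition 3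
    obtain ⟨hmax, hhmax, hStop, hge⟩ := exists_isGreatest_sFlag p hB hB0 h1 hq hnt
    have hN0 : IsN0 E hmax := Or.inl h1
    refine ⟨flagTriple (p ^ e) B E hmax, ⟨false, hmax, hhmax, Or.inl hN0, rfl⟩, ?_⟩
    rw [flagTriple_of_isN0 (p ^ e) B hN0, Prod.Lex.toLex_lt_toLex]
    right
    refine ⟨heq, ?_⟩
    rw [Prod.Lex.toLex_lt_toLex]
    right
    refine ⟨rfl, ?_⟩
    -- `s′ + d! = s⟨X·h⟩ ≤ S < ⊤`
    have hXh : PowerSeries.constantCoeff (PowerSeries.X * h) = 0 := by rw [map_mul, PowerSeries.constantCoeff_X, zero_mul]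
    have hadd := sFlag_stepZero_add_factorial (p ^ e) hB0 hqo hT h0 h1 h1' hq heq h hh
    have hle : sFlag (p ^ e) T E' h + ((dRes B E).factorial : ℕ∞) ≤ sFlag (p ^ e) B E hmax := by
      rw [hadd]; exact hge _ hXh
    obtain ⟨S, hS⟩ := ENat.ne_top_iff_exists.mp (ne_top_of_lt hStop)
    rw [← hS] at hle ⊢
    have hne : sFlag (p ^ e) T E' h ≠ ⊤ := by
      intro htop; rw [htop, top_add] at hle; exact absurd hle (by simp)
    obtain ⟨n, hn⟩ := ENat.ne_top_iff_exists.mp hne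
    rw [← hn] at hle ⊢
    have hfac : 1 ≤ (dRes B E).factorial := Nat.factorial_pos _
    have h2 : n + (dRes B E).factorial ≤ S := by exact_mod_cast hle
    show ((n : ℕ) : ℕ∞) < (S : ℕ∞)
    exact_mod_cast (show n < S by omega)

end NotMem

end PurePowerFlag

end Summit.ResolutionOfSingularities.ResolutionOfSingularities.Theorems
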